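import Summits.QuantumFields.YangMills.Theorems.UnitScaleTiltProp7HermiteInterpolation
import HarnessLib

/-!
# Route `UnitScaleTilt`, crux K1 «MinimiserStabilityRegPr» (stmt-QuantumFields-19200), route-R E′ path (α′), row LEMMA-H-CURVED — FILE 3α:
# THE C¹ CARDINAL WEIGHTS `W_y(x) = Π_ν E_ν(x, y_ν)` OF THE HERMITE BLEND, AS EXPLICIT FUNCTIONS OF THE CENTRE `y`:
# `E_ν(x, t) = p(r_ν)·[Q_ν(x) = t] + (1 − p(r_ν))·[Q_ν(x) + 1 = t]` — partition of unity, values in `[0,1]`, interpolation `W_y(embIter k y′) = δ_(y,y′)`, invariance under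
# steps in other directions, and `|Δ²_μ W_y| ≤ 12∕ℓ²`, `|∇_μ W_y| ≤ 3∕ℓ` — the frame-agnostic half of the (x2′-corner) extension `Φ = Σ_y W_y·Ad(P_y)m(y)`

Cell `ym3-torus`, D-0154 (3c) twin-width seat `ym-routeR-w1` (gen 5); row "routeR-w1 g5: LEMMA-H-CURVED" (namer ★ym-ust-19200-p1 g14, 2026-08-28 17:33Z; design of record
(x2′-corner), bus 18:49Z).  THEOREMS ONLY (0 `def`, 0 `sorry`); `--supports stmt-QuantumFields-19200`, count-neutral.  YM₃ on T³ is a ladder rung (R3), not the Clay problem;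
nothing here claims a stub, the crux, d = 4 or the mass gap.

WHY.  Under the design of record the curved extension is the CORNER BLEND `Φ(x) = Σ_y W_y(x)·Ad(P_y(x)) m(y)` with one (3.35)-type cube gauge per centre `y`
([Balaban1985BackgroundPropagators] (3.35); frames `P_y` abstract in the next file), so the covariant Laplacian splits by the Leibniz rows of ✓ `Prop7ConjFrameTransport`
(★routeR-w4 g9) into weight second differences ⊗ framed constants, weight gradients ⊗ frame variations and weights ⊗ frame second variations.  Everything the WEIGHTS must
supply is flat and is in this file.  The weight of the centre `y` at `x` is the product over directions of the one-dimensional Hermite factor applied to the INDICATOR of the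
`ν`-th block coordinate, `E_ν(x, t) = (H_ν 𝟙[Q_ν = t])(x)` (`Q(x) = B^k(x − h𝟙)` the translated block map of F-H2, `r_ν` the offset of ✓ `Prop7HermiteOffsets`): so the
second-difference row is ✓ `Prop7HermiteSecondDiff.abs_secondDiff_hermStep_le` on a run-constant indicator (`≤ (6∕ℓ²)·2`), the partition of unity is `Σ_t 𝟙[Q_ν = t] = 1`
per direction and `Π_ν Σ_t = Σ_y Π_ν` (`Finset.prod_univ_sum`), interpolation is F-H2's `Q(embIter k y′) = y′` with all offsets zero.

WHAT IS PROVED (ns `…Theorems.Prop7HermiteCardinalWeights`; `ℓ = L^k`, `k ≤ m + K`, offset `h`, profile `p` abstract with displayed rows).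
* §1 the block coordinate: `iterBlockOf_apply_update_ne` (`Q_ν` ignores the other coordinates), `iterBlockOf_apply_longShift` (`Q(x + ℓe_ν) = Q(x) + e_ν`), `ind_runConst`.
* §2 the factor `E_ν`: `hermStep_ind_eq` (`(H_ν𝟙[Q_ν = t])(x) = E_ν(x,t)`), `sum_weightE` (`Σ_t E_ν(x,t) = 1`), `weightE_nonneg`, `weightE_le_one`, `weightE_update_ne`,
  ★ `abs_secondDiff_weightE_le` (`≤ 12∕ℓ²`), ★ `abs_diff_weightE_le` (`≤ 3∕ℓ`, from the displayed slope row `|p(r+1) − p(r)| ≤ 3∕ℓ`), `weightE_embIter` (interpolation).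
* §3 the weight `W_y = Π_ν E_ν(·, y_ν)`: ★ `sum_weight_eq_one`, `weight_nonneg`, `weight_le_one`, ★ `weight_embIter` (`= δ_(y,y′)`), ★★ `secondDiff_weight_eq` (the `μ`-second
  difference factors through `E_μ`'s), ★ `abs_secondDiff_weight_le` (`≤ 12∕ℓ²`).
HONEST SCOPE.  Flat bookkeeping over F-H2's landed rows; no frame, no background, no estimate of Bałaban's.

References: T. Bałaban, CMP 95 (1984) 17–40 [Balaban1984PropagatorsI] ((1.18) p.20, (1.29)–(1.31) p.23); CMP 99 (1985) 389–434 [Balaban1985BackgroundPropagators] ((3.35)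
p.396 — the frames these weights will carry).
-/

set_option autoImplicit false

noncomputable section

open scoped BigOperators

namespace Summit.QuantumFields.YangMills.Theorems.Prop7HermiteCardinalWeights

open Literature.MathematicalPhysics.QuantumFieldTheory.Balaban1983to89
open Finset
open Summit.QuantumFields.YangMills.Theorems.Prop7TentInterpolation (shift_eq_update update_update_add iterBlockOf_update_pow val_embIter)
open Summit.QuantumFields.YangMills.Theorems.Prop7HermiteOffsets (offset_update_ne offset_add_ell offset_shift)
open Summit.QuantumFields.YangMills.Theorems.Prop7HermiteFold (update_comm_abs offset_embIter iterBlockOf_embIter_sub)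
open Summit.QuantumFields.YangMills.Theorems.Prop7HermiteSecondDiff (hermStep_self_eq hermStep_shift_eq abs_secondDiff_hermStep_le)
open Summit.QuantumFields.YangMills.Theorems.Prop7HermiteInterpolation (iterBlockOf_eq_of_div_eq runConst_blockInput)
open B5Eq118OneStroke (iterBlockOf val_iterBlockOf)
open B15DeterminingSets (embIter)

variable {P : Params} {k : ℕ} (hk : k ≤ P.m + P.K) (h : ZMod (P.sitesPerDir 0)) (p : ℕ → ℝ)

/-! ## §1 The block coordinate `Q_ν(x) = B^k(x − h𝟙)_ν` -/

section Block

include hk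

/-- `Q_ν` ignores the other coordinates: `Q_ν(x with x_μ changed) = Q_ν(x)` for `μ ≠ ν`. [cite: Balaban1984PropagatorsI, (1.6) p.18] -/
theorem iterBlockOf_apply_update_ne {μ ν : Fin P.d} (hμν : μ ≠ ν) (x : Site P 0) (b : ZMod (P.sitesPerDir 0)) :
    (iterBlockOf k (fun κ => (Function.update x μ b) κ - h)) ν = (iterBlockOf k (fun κ => x κ - h)) ν := by
  apply ZMod.val_injective
  rw [val_iterBlockOf k hk, val_iterBlockOf k hk]
  simp only [Function.update_of_ne hμν.symm]

/-- `Q(x + ℓe_ν) = Q(x) + e_ν` (one block up). [cite: Balaban1984PropagatorsI, (1.18) p.20] -/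
theorem iterBlockOf_apply_longShift (x : Site P 0) (ν : Fin P.d) :
    iterBlockOf k (fun κ => (Function.update x ν (x ν + ((P.L ^ k : ℕ) : ZMod (P.sitesPerDir 0)))) κ - h) = ((iterBlockOf k (fun κ => x κ - h))).shift ν := by
  have e : (fun κ => (Function.update x ν (x ν + ((P.L ^ k : ℕ) : ZMod (P.sitesPerDir 0)))) κ - h) = Function.update (fun κ => x κ - h) ν ((fun κ => x κ - h) ν + (((P.L ^ k : ℕ) : ℕ) : ZMod (P.sitesPerDir 0))) := by
    funext κ
    by_cases hκ : κ = ν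
    · subst hκ; simp only [Function.update_self]; push_cast; ring
    · simp only [Function.update_of_ne hκ]
  rw [e, iterBlockOf_update_pow hk]

/-- the indicator of a block coordinate is constant along every run. [cite: Balaban1984PropagatorsI, (1.18) p.20] -/
theorem ind_runConst (ν μ : Fin P.d) (t : ZMod (P.sitesPerDir k)) (x : Site P 0) :
    (fun z : Site P 0 => if (iterBlockOf k (fun κ => z κ - h)) ν = t then (1 : ℝ) else 0) x = (fun z : Site P 0 => if (iterBlockOf k (fun κ => z κ - h)) ν = t then (1 : ℝ) else 0) (Function.update x μ (x μ - ((((x μ - h).val % P.L ^ k : ℕ)) : ZMod (P.sitesPerDir 0)))) := by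
  have e := runConst_blockInput h hk (fun q : Site P k => if q ν = t then (1 : ℝ) else 0) μ x
  simpa only using e

end Block

/-! ## §2 The one-dimensional factor `E_ν(x, t) = (H_ν 𝟙[Q_ν = t])(x)` -/

section Factor

include hk

/-- **THE FACTOR IS ONE HERMITE STEP OF AN INDICATOR**: `(H_ν 𝟙[Q_ν = t])(x) = p(r_ν)·[Q_ν(x) = t] + (1 − p(r_ν))·[Q_ν(x) + 1 = t]`.
[cite: Balaban1984PropagatorsI, (1.18) p.20] -/
theorem hermStep_ind_eq (ν : Fin P.d) (t : ZMod (P.sitesPerDir k)) (x : Site P 0) :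
    (p ((x ν - h).val % P.L ^ k) * (fun z : Site P 0 => if (iterBlockOf k (fun κ => z κ - h)) ν = t then (1 : ℝ) else 0) (Function.update x ν (x ν - ((((x ν - h).val % P.L ^ k : ℕ)) : ZMod (P.sitesPerDir 0)))) + (1 - p ((x ν - h).val % P.L ^ k)) * (fun z : Site P 0 => if (iterBlockOf k (fun κ => z κ - h)) ν = t then (1 : ℝ) else 0) (Function.update x ν (x ν - ((((x ν - h).val % P.L ^ k : ℕ)) : ZMod (P.sitesPerDir 0)) + ((P.L ^ k : ℕ) : ZMod (P.sitesPerDir 0))))) = (p ((x ν - h).val % P.L ^ k) * (if (iterBlockOf k (fun κ => x κ - h)) ν = t then (1 : ℝ) else 0) + (1 - p ((x ν - h).val % P.L ^ k)) * (if (iterBlockOf k (fun κ => x κ - h)) ν + 1 = t then (1 : ℝ) else 0)) := by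
  have hℓN : P.L ^ k ∣ P.sitesPerDir 0 := ⟨P.sitesPerDir k, by
    unfold Params.sitesPerDir; rw [Nat.sub_zero, mul_left_comm, ← pow_add, Nat.add_sub_cancel' hk]⟩
  rw [hermStep_self_eq (P.L ^ k) h p hℓN ν _ (fun z => ind_runConst hk h ν ν t z) x]
  simp only [iterBlockOf_apply_longShift hk h x ν, Site.shift, Function.update_self]

omit hk in
/-- `Σ_t E_ν(x, t) = 1` (the two indicators each sum to one). [folklore] -/
theorem sum_weightE (ν : Fin P.d) (x : Site P 0) : ∑ t : ZMod (P.sitesPerDir k), (p ((x ν - h).val % P.L ^ k) * (if (iterBlockOf k (fun κ => x κ - h)) ν = t then (1 : ℝ) else 0) + (1 - p ((x ν - h).val % P.L ^ k)) * (if (iterBlockOf k (fun κ => x κ - h)) ν + 1 = t then (1 : ℝ) else 0)) = 1 := by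
  rw [Finset.sum_add_distrib, ← Finset.mul_sum, ← Finset.mul_sum, Finset.sum_ite_eq, Finset.sum_ite_eq]
  simp

omit hk in
/-- `0 ≤ E_ν(x,t)` (profile values in `[0,1]`). [folklore] -/
theorem weightE_nonneg (hp01 : ∀ r : ℕ, r < P.L ^ k → 0 ≤ p r ∧ p r ≤ 1) (ν : Fin P.d) (t : ZMod (P.sitesPerDir k)) (x : Site P 0) :
    0 ≤ (p ((x ν - h).val % P.L ^ k) * (if (iterBlockOf k (fun κ => x κ - h)) ν = t then (1 : ℝ) else 0) + (1 - p ((x ν - h).val % P.L ^ k)) * (if (iterBlockOf k (fun κ => x κ - h)) ν + 1 = t then (1 : ℝ) else 0)) := by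
  obtain ⟨h0, h1⟩ := hp01 _ (Nat.mod_lt ((x ν - h).val) (pow_pos P.L_pos k))
  have hi1 : (0 : ℝ) ≤ (if (iterBlockOf k (fun κ => x κ - h)) ν = t then (1 : ℝ) else 0) := by split_ifs <;> norm_num
  have hi2 : (0 : ℝ) ≤ (if (iterBlockOf k (fun κ => x κ - h)) ν + 1 = t then (1 : ℝ) else 0) := by split_ifs <;> norm_num
  have : 0 ≤ 1 - p ((x ν - h).val % P.L ^ k) := by linarith
  positivity

omit hk in
/-- `E_ν(x,t) ≤ 1`. [folklore] -/
theorem weightE_le_one (hp01 : ∀ r : ℕ, r < P.L ^ k → 0 ≤ p r ∧ p r ≤ 1) (ν : Fin P.d) (t : ZMod (P.sitesPerDir k)) (x : Site P 0) :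
    (p ((x ν - h).val % P.L ^ k) * (if (iterBlockOf k (fun κ => x κ - h)) ν = t then (1 : ℝ) else 0) + (1 - p ((x ν - h).val % P.L ^ k)) * (if (iterBlockOf k (fun κ => x κ - h)) ν + 1 = t then (1 : ℝ) else 0)) ≤ 1 := by
  obtain ⟨h0, h1⟩ := hp01 _ (Nat.mod_lt ((x ν - h).val) (pow_pos P.L_pos k))
  have hi1 : (if (iterBlockOf k (fun κ => x κ - h)) ν = t then (1 : ℝ) else 0) ≤ 1 := by split_ifs <;> norm_num
  have hi2 : (if (iterBlockOf k (fun κ => x κ - h)) ν + 1 = t then (1 : ℝ) else 0) ≤ 1 := by split_ifs <;> norm_num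
  have hi1' : (0 : ℝ) ≤ (if (iterBlockOf k (fun κ => x κ - h)) ν = t then (1 : ℝ) else 0) := by split_ifs <;> norm_num
  have hi2' : (0 : ℝ) ≤ (if (iterBlockOf k (fun κ => x κ - h)) ν + 1 = t then (1 : ℝ) else 0) := by split_ifs <;> norm_num
  nlinarith

/-- a step in another direction does not change the factor. [folklore] -/
theorem weightE_update_ne {μ ν : Fin P.d} (hμν : μ ≠ ν) (t : ZMod (P.sitesPerDir k)) (x : Site P 0) (b : ZMod (P.sitesPerDir 0)) :
    (p (((Function.update x μ b) ν - h).val % P.L ^ k) * (if (iterBlockOf k (fun κ => (Function.update x μ b) κ - h)) ν = t then (1 : ℝ) else 0) + (1 - p (((Function.update x μ b) ν - h).val % P.L ^ k)) * (if (iterBlockOf k (fun κ => (Function.update x μ b) κ - h)) ν + 1 = t then (1 : ℝ) else 0)) = (p ((x ν - h).val % P.L ^ k) * (if (iterBlockOf k (fun κ => x κ - h)) ν = t then (1 : ℝ) else 0) + (1 - p ((x ν - h).val % P.L ^ k)) * (if (iterBlockOf k (fun κ => x κ - h)) ν + 1 = t then (1 : ℝ) else 0)) := by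
  rw [iterBlockOf_apply_update_ne hk h hμν, Function.update_of_ne hμν.symm]

/-- ★ **SECOND DIFFERENCES OF THE FACTOR ARE `O(ℓ⁻²)`**: `|E_ν(x+e_ν,t) − 2E_ν(x,t) + E_ν(x−e_ν,t)| ≤ 12∕ℓ²` — ✓ `abs_secondDiff_hermStep_le` on the run-constant indicator,
whose long differences are at most `1` each. [cite: Balaban1984PropagatorsI, (1.29)-(1.31) p.23] -/
theorem abs_secondDiff_weightE_le (hp0 : p 0 = 1) (hpℓ : p (P.L ^ k) = 0)
    (hpD : ∀ r : ℕ, 1 ≤ r → r + 1 ≤ P.L ^ k → |p (r + 1) - 2 * p r + p (r - 1)| ≤ 6 / (((P.L ^ k : ℕ) : ℝ)) ^ 2)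
    (hpc : p 1 + p (P.L ^ k - 1) = 1) (hpk0 : 0 ≤ p (P.L ^ k - 1)) (hpk : p (P.L ^ k - 1) ≤ 3 / (((P.L ^ k : ℕ) : ℝ)) ^ 2)
    (ν : Fin P.d) (t : ZMod (P.sitesPerDir k)) (x : Site P 0) :
    |(p (((x.shift ν) ν - h).val % P.L ^ k) * (if (iterBlockOf k (fun κ => (x.shift ν) κ - h)) ν = t then (1 : ℝ) else 0) + (1 - p (((x.shift ν) ν - h).val % P.L ^ k)) * (if (iterBlockOf k (fun κ => (x.shift ν) κ - h)) ν + 1 = t then (1 : ℝ) else 0)) - 2 * (p ((x ν - h).val % P.L ^ k) * (if (iterBlockOf k (fun κ => x κ - h)) ν = t then (1 : ℝ) else 0) + (1 - p ((x ν - h).val % P.L ^ k)) * (if (iterBlockOf k (fun κ => x κ - h)) ν + 1 = t then (1 : ℝ) else 0)) + (p (((x.unshift ν) ν - h).val % P.L ^ k) * (if (iterBlockOf k (fun κ => (x.unshift ν) κ - h)) ν = t then (1 : ℝ) else 0) + (1 - p (((x.unshift ν) ν - h).val % P.L ^ k)) * (if (iterBlockOf k (fun κ => (x.unshift ν) κ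 - h)) ν + 1 = t then (1 : ℝ) else 0))| ≤ 12 / (((P.L ^ k : ℕ) : ℝ)) ^ 2 := by
  have hℓN : P.L ^ k ∣ P.sitesPerDir 0 := ⟨P.sitesPerDir k, by
    unfold Params.sitesPerDir; rw [Nat.sub_zero, mul_left_comm, ← pow_add, Nat.add_sub_cancel' hk]⟩
  have hℓ : 0 < P.L ^ k := pow_pos P.L_pos k
  rw [← hermStep_ind_eq hk h p ν t (x.shift ν), ← hermStep_ind_eq hk h p ν t x, ← hermStep_ind_eq hk h p ν t (x.unshift ν)]
  have hb := abs_secondDiff_hermStep_le (P.L ^ k) h p hℓN hℓ hp0 hpℓ hpD hpc hpk0 hpk ν (fun z : Site P 0 => if (iterBlockOf k (fun κ => z κ - h)) ν = t then (1 : ℝ) else 0) (fun z => ind_runConst hk h ν ν t z) x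
  refine hb.trans ?_
  have h1 : |(fun z : Site P 0 => if (iterBlockOf k (fun κ => z κ - h)) ν = t then (1 : ℝ) else 0) (Function.update x ν (x ν + ((P.L ^ k : ℕ) : ZMod (P.sitesPerDir 0)))) - (fun z : Site P 0 => if (iterBlockOf k (fun κ => z κ - h)) ν = t then (1 : ℝ) else 0) x| ≤ 1 := by
    simp only []; split_ifs <;> norm_num
  have h2 : |(fun z : Site P 0 => if (iterBlockOf k (fun κ => z κ - h)) ν = t then (1 : ℝ) else 0) x - (fun z : Site P 0 => if (iterBlockOf k (fun κ => z κ - h)) ν = t then (1 : ℝ) else 0) (Function.update x ν (x ν - ((P.L ^ k : ℕ) : ZMod (P.sitesPerDir 0))))| ≤ 1 := by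
    simp only []; split_ifs <;> norm_num
  have hℓr : (0 : ℝ) < ((P.L ^ k : ℕ) : ℝ) := by exact_mod_cast hℓ
  have h3 : 6 / (((P.L ^ k : ℕ) : ℝ)) ^ 2 * (|(fun z : Site P 0 => if (iterBlockOf k (fun κ => z κ - h)) ν = t then (1 : ℝ) else 0) (Function.update x ν (x ν + ((P.L ^ k : ℕ) : ZMod (P.sitesPerDir 0)))) - (fun z : Site P 0 => if (iterBlockOf k (fun κ => z κ - h)) ν = t then (1 : ℝ) else 0) x| + |(fun z : Site P 0 => if (iterBlockOf k (fun κ => z κ - h)) ν = t then (1 : ℝ) else 0) x - (fun z : Site P 0 => if (iterBlockOf k (fun κ => z κ - h)) ν = t then (1 : ℝ) else 0) (Function.update x ν (x ν - ((P.L ^ k : ℕ) : ZMod (P.sitesPerDir 0))))|) ≤ 6 / (((P.L ^ k : ℕ) : ℝ)) ^ 2 * 2 :=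
    mul_le_mul_of_nonneg_left (by linarith) (by positivity)
  rw [show (12 : ℝ) / (((P.L ^ k : ℕ) : ℝ)) ^ 2 = 6 / (((P.L ^ k : ℕ) : ℝ)) ^ 2 * 2 by ring]
  exact h3

/-- ★ **FIRST DIFFERENCES OF THE FACTOR ARE `O(ℓ⁻¹)`**: `|E_ν(x+e_ν,t) − E_ν(x,t)| ≤ 3∕ℓ` given the slope row `|p(r+1) − p(r)| ≤ 3∕ℓ` (`r + 1 ≤ ℓ`) and `p(ℓ) = 0`.
[cite: Balaban1984PropagatorsI, (1.29)-(1.31) p.23] -/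
theorem abs_diff_weightE_le (hp0 : p 0 = 1) (hpℓ : p (P.L ^ k) = 0) (hpS : ∀ r : ℕ, r + 1 ≤ P.L ^ k → |p (r + 1) - p r| ≤ 3 / (((P.L ^ k : ℕ) : ℝ)))
    (ν : Fin P.d) (t : ZMod (P.sitesPerDir k)) (x : Site P 0) :
    |(p (((x.shift ν) ν - h).val % P.L ^ k) * (if (iterBlockOf k (fun κ => (x.shift ν) κ - h)) ν = t then (1 : ℝ) else 0) + (1 - p (((x.shift ν) ν - h).val % P.L ^ k)) * (if (iterBlockOf k (fun κ => (x.shift ν) κ - h)) ν + 1 = t then (1 : ℝ) else 0)) - (p ((x ν - h).val % P.L ^ k) * (if (iterBlockOf k (fun κ => x κ - h)) ν = t then (1 : ℝ) else 0) + (1 - p ((x ν - h).val % P.L ^ k)) * (if (iterBlockOf k (fun κ => x κ - h)) ν + 1 = t then (1 : ℝ) else 0))| ≤ 3 / (((P.L ^ k : ℕ) : ℝ)) := by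
  have hℓN : P.L ^ k ∣ P.sitesPerDir 0 := ⟨P.sitesPerDir k, by
    unfold Params.sitesPerDir; rw [Nat.sub_zero, mul_left_comm, ← pow_add, Nat.add_sub_cancel' hk]⟩
  have hℓ : 0 < P.L ^ k := pow_pos P.L_pos k
  have hw := fun z => ind_runConst hk h ν ν t z
  rw [← hermStep_ind_eq hk h p ν t (x.shift ν), ← hermStep_ind_eq hk h p ν t x,
    hermStep_shift_eq (P.L ^ k) h p hℓN hℓ hp0 hpℓ ν _ hw x, hermStep_self_eq (P.L ^ k) h p hℓN ν _ hw x]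
  have hr : (x ν - h).val % P.L ^ k + 1 ≤ P.L ^ k := Nat.mod_lt _ hℓ
  have e : p ((x ν - h).val % P.L ^ k + 1) * (fun z : Site P 0 => if (iterBlockOf k (fun κ => z κ - h)) ν = t then (1 : ℝ) else 0) x + (1 - p ((x ν - h).val % P.L ^ k + 1)) * (fun z : Site P 0 => if (iterBlockOf k (fun κ => z κ - h)) ν = t then (1 : ℝ) else 0) (Function.update x ν (x ν + ((P.L ^ k : ℕ) : ZMod (P.sitesPerDir 0))))
      - (p ((x ν - h).val % P.L ^ k) * (fun z : Site P 0 => if (iterBlockOf k (fun κ => z κ - h)) ν = t then (1 : ℝ) else 0) x + (1 - p ((x ν - h).val % P.L ^ k)) * (fun z : Site P 0 => if (iterBlockOf k (fun κ => z κ - h)) ν = t then (1 : ℝ) else 0) (Function.update x ν (x ν + ((P.L ^ k : ℕ) : ZMod (P.sitesPerDir 0)))))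
      = (p ((x ν - h).val % P.L ^ k + 1) - p ((x ν - h).val % P.L ^ k)) * ((fun z : Site P 0 => if (iterBlockOf k (fun κ => z κ - h)) ν = t then (1 : ℝ) else 0) x - (fun z : Site P 0 => if (iterBlockOf k (fun κ => z κ - h)) ν = t then (1 : ℝ) else 0) (Function.update x ν (x ν + ((P.L ^ k : ℕ) : ZMod (P.sitesPerDir 0))))) := by ring
  rw [e, abs_mul]
  have h1 : |(fun z : Site P 0 => if (iterBlockOf k (fun κ => z κ - h)) ν = t then (1 : ℝ) else 0) x - (fun z : Site P 0 => if (iterBlockOf k (fun κ => z κ - h)) ν = t then (1 : ℝ) else 0) (Function.update x ν (x ν + ((P.L ^ k : ℕ) : ZMod (P.sitesPerDir 0))))| ≤ 1 := by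
    simp only []; split_ifs <;> norm_num
  calc |p ((x ν - h).val % P.L ^ k + 1) - p ((x ν - h).val % P.L ^ k)| * |(fun z : Site P 0 => if (iterBlockOf k (fun κ => z κ - h)) ν = t then (1 : ℝ) else 0) x - (fun z : Site P 0 => if (iterBlockOf k (fun κ => z κ - h)) ν = t then (1 : ℝ) else 0) (Function.update x ν (x ν + ((P.L ^ k : ℕ) : ZMod (P.sitesPerDir 0))))|
      ≤ 3 / (((P.L ^ k : ℕ) : ℝ)) * 1 := mul_le_mul (hpS _ hr) h1 (abs_nonneg _) (by positivity)
    _ = 3 / (((P.L ^ k : ℕ) : ℝ)) := mul_one _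

end Factor

section Centre

variable (p : ℕ → ℝ)
include hk

/-- **INTERPOLATION OF THE FACTOR**: at a centre all offsets vanish and `Q(embIter k y′) = y′`, so `E_ν(embIter k y′, t) = [y′_ν = t]` (`h = (L^k − 1)∕2`, `p(0) = 1`).
[cite: Balaban1984PropagatorsI, (1.18) p.20] -/
theorem weightE_embIter (hp0 : p 0 = 1) (ν : Fin P.d) (t : ZMod (P.sitesPerDir k)) (y' : Site P k) :
    (p (((embIter k y') ν - ((((P.L ^ k - 1) / 2 : ℕ)) : ZMod (P.sitesPerDir 0))).val % P.L ^ k) * (if (iterBlockOf k (fun κ => (embIter k y') κ - ((((P.L ^ k - 1) / 2 : ℕ)) : ZMod (P.sitesPerDir 0)))) ν = t then (1 : ℝ) else 0) + (1 - p (((embIter k y') ν - ((((P.L ^ k - 1) / 2 : ℕ)) : ZMod (P.sitesPerDir 0))).val % P.L ^ k)) * (if (iterBlockOf k (fun κ => (embIter k y') κ - ((((P.L ^ k - 1) / 2 : ℕ)) : ZMod (P.sitesPerDir 0)))) ν + 1 = t then (1 : ℝ) else 0)) = if y' ν = t then (1 : ℝ) else 0 := by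
  rw [offset_embIter hk y' ν, hp0, iterBlockOf_embIter_sub hk y']
  by_cases hy : y' ν = t
  · have hne : ¬ (y' ν + 1 = t) := by
      rw [← hy]; intro hc
      have h2 : (2 : ℕ) ≤ P.sitesPerDir k := by
        unfold Params.sitesPerDir; have := Nat.one_le_pow (P.m + P.K - k) P.L P.L_pos; omega
      have h1 : (1 : ZMod (P.sitesPerDir k)) = 0 :=
        calc (1 : ZMod (P.sitesPerDir k)) = (y' ν + 1) - y' ν := by ring
          _ = 0 := by rw [hc, sub_self]
      haveI : Fact (1 < P.sitesPerDir k) := ⟨h2⟩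
      exact one_ne_zero h1
    rw [if_pos hy, if_neg hne]; ring
  · rw [if_neg hy]
    split_ifs <;> ring

/-- ★ **INTERPOLATION OF THE WEIGHT**: `W_y(embIter k y′) = δ_(y, y′)`. [cite: Balaban1984PropagatorsI, (1.18) p.20] -/
theorem weight_embIter (hp0 : p 0 = 1) (y yc : Site P k) :
    (∏ ν : Fin P.d, (p (((embIter k yc) ν - ((((P.L ^ k - 1) / 2 : ℕ)) : ZMod (P.sitesPerDir 0))).val % P.L ^ k) * (if (iterBlockOf k (fun κ => (embIter k yc) κ - ((((P.L ^ k - 1) / 2 : ℕ)) : ZMod (P.sitesPerDir 0)))) ν = y ν then (1 : ℝ) else 0) + (1 - p (((embIter k yc) ν - ((((P.L ^ k - 1) / 2 : ℕ)) : ZMod (P.sitesPerDir 0))).val % P.L ^ k)) * (if (iterBlockOf k (fun κ => (embIter k yc) κ - ((((P.L ^ k - 1) / 2 : ℕ)) : ZMod (P.sitesPerDir 0)))) ν + 1 = y ν then (1 : ℝ) else 0))) = if yc = y then (1 : ℝ) else 0 := by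
  simp only [weightE_embIter hk p hp0]
  by_cases hy : yc = y
  · subst hy; simp
  · rw [if_neg hy]
    obtain ⟨ν, hν⟩ := Function.ne_iff.mp hy
    exact Finset.prod_eq_zero (Finset.mem_univ ν) (if_neg hν)

end Centre

/-! ## §3 The weight `W_y(x) = Π_ν E_ν(x, y_ν)` -/

section Weight

variable (p : ℕ → ℝ)

/-- ★ **PARTITION OF UNITY**: `Σ_y W_y(x) = 1` (`Π_ν Σ_t E_ν = Σ_y Π_ν E_ν(·, y_ν)`). [folklore] -/
theorem sum_weight_eq_one (x : Site P 0) : ∑ y : Site P k, (∏ ν : Fin P.d, (p ((x ν - h).val % P.L ^ k) * (if (iterBlockOf k (fun κ => x κ - h)) ν = y ν then (1 : ℝ) else 0) + (1 - p ((x ν - h).val % P.L ^ k)) * (if (iterBlockOf k (fun κ => x κ - h)) ν + 1 = y ν then (1 : ℝ) else 0))) = 1 := by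
  have hsite : (∑ y : Site P k, (∏ ν : Fin P.d, (p ((x ν - h).val % P.L ^ k) * (if (iterBlockOf k (fun κ => x κ - h)) ν = y ν then (1 : ℝ) else 0) + (1 - p ((x ν - h).val % P.L ^ k)) * (if (iterBlockOf k (fun κ => x κ - h)) ν + 1 = y ν then (1 : ℝ) else 0)))) = ∏ ν : Fin P.d, ∑ t : ZMod (P.sitesPerDir k), (p ((x ν - h).val % P.L ^ k) * (if (iterBlockOf k (fun κ => x κ - h)) ν = t then (1 : ℝ) else 0) + (1 - p ((x ν - h).val % P.L ^ k)) * (if (iterBlockOf k (fun κ => x κ - h)) ν + 1 = t then (1 : ℝ) else 0)) := by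
    rw [Finset.prod_univ_sum]
    rfl
  rw [hsite]
  exact Finset.prod_eq_one fun ν _ => sum_weightE h p ν x

/-- `0 ≤ W_y(x)`. [folklore] -/
theorem weight_nonneg (hp01 : ∀ r : ℕ, r < P.L ^ k → 0 ≤ p r ∧ p r ≤ 1) (y : Site P k) (x : Site P 0) : 0 ≤ (∏ ν : Fin P.d, (p ((x ν - h).val % P.L ^ k) * (if (iterBlockOf k (fun κ => x κ - h)) ν = y ν then (1 : ℝ) else 0) + (1 - p ((x ν - h).val % P.L ^ k)) * (if (iterBlockOf k (fun κ => x κ - h)) ν + 1 = y ν then (1 : ℝ) else 0))) :=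
  Finset.prod_nonneg fun ν _ => weightE_nonneg h p hp01 ν (y ν) x

/-- `W_y(x) ≤ 1`. [folklore] -/
theorem weight_le_one (hp01 : ∀ r : ℕ, r < P.L ^ k → 0 ≤ p r ∧ p r ≤ 1) (y : Site P k) (x : Site P 0) : (∏ ν : Fin P.d, (p ((x ν - h).val % P.L ^ k) * (if (iterBlockOf k (fun κ => x κ - h)) ν = y ν then (1 : ℝ) else 0) + (1 - p ((x ν - h).val % P.L ^ k)) * (if (iterBlockOf k (fun κ => x κ - h)) ν + 1 = y ν then (1 : ℝ) else 0))) ≤ 1 :=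
  Finset.prod_le_one (fun ν _ => weightE_nonneg h p hp01 ν (y ν) x) (fun ν _ => weightE_le_one h p hp01 ν (y ν) x)

include hk

/-- ★★ **THE `μ`-SECOND DIFFERENCE OF THE WEIGHT FACTORS THROUGH `E_μ`**: the other factors do not see a step in direction `μ`, so
`W_y(x+e_μ) − 2W_y(x) + W_y(x−e_μ) = (E_μ(x+e_μ) − 2E_μ(x) + E_μ(x−e_μ))·Π_(ν≠μ) E_ν(x, y_ν)`. [folklore] -/
theorem secondDiff_weight_eq (y : Site P k) (μ : Fin P.d) (x : Site P 0) :
    (∏ ν : Fin P.d, (p (((x.shift μ) ν - h).val % P.L ^ k) * (if (iterBlockOf k (fun κ => (x.shift μ) κ - h)) ν = y ν then (1 : ℝ) else 0) + (1 - p (((x.shift μ) ν - h).val % P.L ^ k)) * (if (iterBlockOf k (fun κ => (x.shift μ) κ - h)) ν + 1 = y ν then (1 : ℝ) else 0))) - 2 * (∏ ν : Fin P.d, (p ((x ν - h).val % P.L ^ k) * (if (iterBlockOf k (fun κ => x κ - h)) ν = y ν then (1 : ℝ) else 0) + (1 - p ((x ν - h).val % P.L ^ k)) * (if (iterBlockOf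 k (fun κ => x κ - h)) ν + 1 = y ν then (1 : ℝ) else 0))) + (∏ ν : Fin P.d, (p (((x.unshift μ) ν - h).val % P.L ^ k) * (if (iterBlockOf k (fun κ => (x.unshift μ) κ - h)) ν = y ν then (1 : ℝ) else 0) + (1 - p (((x.unshift μ) ν - h).val % P.L ^ k)) * (if (iterBlockOf k (fun κ => (x.unshift μ) κ - h)) ν + 1 = y ν then (1 : ℝ) else 0)))
      = ((p (((x.shift μ) μ - h).val % P.L ^ k) * (if (iterBlockOf k (fun κ => (x.shift μ) κ - h)) μ = y μ then (1 : ℝ) else 0) + (1 - p (((x.shift μ) μ - h).val % P.L ^ k)) * (if (iterBlockOf k (fun κ => (x.shift μ) κ - h)) μ + 1 = y μ then (1 : ℝ) else 0)) - 2 * (p ((x μ - h).val % P.L ^ k) * (if (iterBlockOf k (fun κ => x κ - h)) μ = y μ then (1 : ℝ) else 0) + (1 - p ((x μ - h).val % P.L ^ k)) * (if (iterBlockOf k (fun κ => x κ - h)) μ + 1 = y μ then (1 : ℝ) else 0)) + (p (((x.unshift μ) μ - h).val % P.L ^ k) * (if (iterBlockOf k (fun κ => (x.unshift μ) κ - h))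 μ = y μ then (1 : ℝ) else 0) + (1 - p (((x.unshift μ) μ - h).val % P.L ^ k)) * (if (iterBlockOf k (fun κ => (x.unshift μ) κ - h)) μ + 1 = y μ then (1 : ℝ) else 0))) * ∏ ν ∈ Finset.univ.erase μ, (p ((x ν - h).val % P.L ^ k) * (if (iterBlockOf k (fun κ => x κ - h)) ν = y ν then (1 : ℝ) else 0) + (1 - p ((x ν - h).val % P.L ^ k)) * (if (iterBlockOf k (fun κ => x κ - h)) ν + 1 = y ν then (1 : ℝ) else 0)) := by
  have hs : ∀ ν ∈ Finset.univ.erase μ, (p (((x.shift μ) ν - h).val % P.L ^ k) * (if (iterBlockOf k (fun κ => (x.shift μ) κ - h)) ν = y ν then (1 : ℝ) else 0) + (1 - p (((x.shift μ) ν - h).val % P.L ^ k)) * (if (iterBlockOf k (fun κ => (x.shift μ) κ - h)) ν + 1 = y ν then (1 : ℝ) else 0)) = (p ((x ν - h).val % P.L ^ k) * (if (iterBlockOf k (fun κ => x κ - h)) ν = y ν then (1 : ℝ) else 0) + (1 - p ((x ν - h).val % P.L ^ k)) * (if (iterBlockOf k (fun κ => x κ - h)) ν + 1 = y ν then (1 :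 ℝ) else 0)) := by
    intro ν hν
    have hμν : μ ≠ ν := fun e => (Finset.mem_erase.mp hν).1 e.symm
    rw [shift_eq_update]
    exact weightE_update_ne hk h p hμν (y ν) x _
  have hu : ∀ ν ∈ Finset.univ.erase μ, (p (((x.unshift μ) ν - h).val % P.L ^ k) * (if (iterBlockOf k (fun κ => (x.unshift μ) κ - h)) ν = y ν then (1 : ℝ) else 0) + (1 - p (((x.unshift μ) ν - h).val % P.L ^ k)) * (if (iterBlockOf k (fun κ => (x.unshift μ) κ - h)) ν + 1 = y ν then (1 : ℝ) else 0)) = (p ((x ν - h).val % P.L ^ k) * (if (iterBlockOf k (fun κ => x κ - h)) ν = y ν then (1 : ℝ) else 0) + (1 - p ((x ν - h).val % P.L ^ k)) * (if (iterBlockOf k (fun κ => x κ - h)) ν + 1 = y ν then (1 : ℝ) else 0)) := by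
    intro ν hν
    have hμν : μ ≠ ν := fun e => (Finset.mem_erase.mp hν).1 e.symm
    show (p ((Function.update x μ (x μ - 1) ν - h).val % P.L ^ k) * (if (iterBlockOf k (fun κ => (Function.update x μ (x μ - 1)) κ - h)) ν = y ν then (1 : ℝ) else 0)
      + (1 - p ((Function.update x μ (x μ - 1) ν - h).val % P.L ^ k)) * (if (iterBlockOf k (fun κ => (Function.update x μ (x μ - 1)) κ - h)) ν + 1 = y ν then (1 : ℝ) else 0)) = _
    exact weightE_update_ne hk h p hμν (y ν) x _
  rw [← Finset.mul_prod_erase (Finset.univ) (fun ν => (p (((x.shift μ) ν - h).val % P.L ^ k) * (if (iterBlockOf k (fun κ => (x.shift μ) κ - h)) ν = y ν then (1 : ℝ) else 0) + (1 - p (((x.shift μ) ν - h).val % P.L ^ k)) * (if (iterBlockOf k (fun κ => (x.shift μ) κ - h)) ν + 1 = y ν then (1 : ℝ) else 0))) (Finset.mem_univ μ),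
    ← Finset.mul_prod_erase (Finset.univ) (fun ν => (p ((x ν - h).val % P.L ^ k) * (if (iterBlockOf k (fun κ => x κ - h)) ν = y ν then (1 : ℝ) else 0) + (1 - p ((x ν - h).val % P.L ^ k)) * (if (iterBlockOf k (fun κ => x κ - h)) ν + 1 = y ν then (1 : ℝ) else 0))) (Finset.mem_univ μ),
    ← Finset.mul_prod_erase (Finset.univ) (fun ν => (p (((x.unshift μ) ν - h).val % P.L ^ k) * (if (iterBlockOf k (fun κ => (x.unshift μ) κ - h)) ν = y ν then (1 : ℝ) else 0) + (1 - p (((x.unshift μ) ν - h).val % P.L ^ k)) * (if (iterBlockOf k (fun κ => (x.unshift μ) κ - h)) ν + 1 = y ν then (1 : ℝ) else 0))) (Finset.mem_univ μ),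
    Finset.prod_congr rfl hs, Finset.prod_congr rfl hu]
  ring

end Weight

end Summit.QuantumFields.YangMills.Theorems.Prop7HermiteCardinalWeights

end
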